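import Literature.AnabelianGeometry.AbsoluteAnabelian.MonoidKummerMapsTLGLiftLevels
import HarnessLib

/-!
# [AbsTopIII] Prop 3.2 (iv) / [AbsAnab] Prop 1.2.1 (iii),(iv): GLUING the levelwise transports of
# `K_U^×` to the bi-anabelian statement for `k̄^×` (row "TLG lifting ⇐ LCFT facts by name",
# STAGE 2, brick 3)

Proof-only companion (theorems only, no new definitions), sequel of
`MonoidKummerMapsTLGLiftLevels.lean`.  For MLFs `k₁, k₂` (only `Field` + `CharZero` are used here) and
a topological isomorphism `α : G_{k₁} ⥲ G_{k₂}` of absolute Galois groups, GIVEN reciprocity data at the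
open normal levels — maps `Art_U : K_U^× → U^ab` (`K_U` = fixed field of `U`) on both sides which are
injective, conjugation-equivariant (Neukirch IV (5.8)), compatible with inclusion/Verlagerung (Neukirch
IV (5.9)) and whose ranges correspond under `α^ab` ([AbsAnab] Prop. 1.2.1 (iii) at the finite levels)
— the levelwise bijections `β_U = Art₂⁻¹ ∘ α^ab ∘ Art₁` glue to an `α`-equivariant multiplicative
bijection `k̄₁^× ⥲ k̄₂^×` ("the copy of `M` embedded in abelianizations of open subgroups of `G` via
local class field theory", [AbsTopIII] Prop. 3.2 (iv) proof pp. 72–73, kurims `paper:url-5493eb38cbb7`):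

* `biAnabelianUnits_absoluteGaloisGroup_of_levelFamilies` — the bi-anabelian statement for
  `(AlgebraicClosure kᵢ)^×` from the level families.

With `MonoidKummerMapsTLGLiftTransport` (any algebraic closure) and `MonoidKummerMapsTLGLiftReduction`
(pairs), every surjectivity sentence of `MonoidKummerMaps.lean` follows once the level families are
instantiated from the tree's local class field theory (abc-iut-L6-t11
`exists_reciprocity_characterized_embField_general` p415774 incl. the range clause, abc-iut-L4-t11
`verlagerung_apply_eq_of_characterized` p414364, `galoisMLF_iso_unitImage_holds` p412652; the per-level
packaging is abc-iut-L6-t11's adapter, in flight).  HONEST FRAMING: OUR kernel check of a reduction;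
nothing here bears on [IUTchIII] Cor. 3.12.
-/

noncomputable section

open scoped Classical nonZeroDivisors

namespace Literature.AnabelianGeometry.AbsoluteAnabelian

open Field

/-! ### §1. Fixed fields of open normal subgroups of `G_k` -/

section Single

variable {k : Type} [Field k]

/-- Membership in the fixed field of `U ≤ G_k` (`U` viewed in `Aut_k(k̄)` through `toAlgEquiv`).
[folklore] -/
private theorem mem_fixedField_map_iff (U : Subgroup (absoluteGaloisGroup k)) (x : AlgebraicClosure k) :
    x ∈ IntermediateField.fixedField (U.map (absoluteGaloisGroup.toAlgEquiv k).toMonoidHom) ↔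
      ∀ τ ∈ U, τ • x = x := by
  rw [IntermediateField.mem_fixedField_iff]
  constructor
  · intro h τ hτ
    rw [absoluteGaloisGroup.smul_def]
    exact h _ (Subgroup.mem_map_of_mem _ hτ)
  · rintro h f ⟨τ, hτ, rfl⟩
    exact h τ hτ

/-- The fixed field of a NORMAL subgroup of `G_k` is `G_k`-stable. [folklore] -/
private theorem smul_mem_fixedField_map (U : Subgroup (absoluteGaloisGroup k)) (hN : U.Normal)
    (σ : absoluteGaloisGroup k) {x : AlgebraicClosure k}
    (hx : x ∈ IntermediateField.fixedField (U.map (absoluteGaloisGroup.toAlgEquiv k).toMonoidHom)) :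
    σ • x ∈ IntermediateField.fixedField (U.map (absoluteGaloisGroup.toAlgEquiv k).toMonoidHom) := by
  rw [mem_fixedField_map_iff] at hx ⊢
  intro τ hτ
  have h1 : (σ⁻¹ * τ * σ⁻¹⁻¹) • x = x := hx _ (hN.conj_mem τ hτ σ⁻¹)
  rw [inv_inv] at h1
  calc τ • σ • x = σ • ((σ⁻¹ * τ * σ) • x) := by rw [mul_smul, mul_smul, smul_inv_smul]
    _ = σ • x := by rw [h1]

variable [CharZero k]

/-- Every element of `k̄` lies in the fixed field of some open normal subgroup of `G_k` (the Galois
group of the normal closure of `k(x)`). [folklore] -/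
private theorem exists_open_normal_mem_fixedField (x : AlgebraicClosure k) :
    ∃ U : Subgroup (absoluteGaloisGroup k), IsOpen (U : Set (absoluteGaloisGroup k)) ∧ U.Normal ∧
      x ∈ IntermediateField.fixedField (U.map (absoluteGaloisGroup.toAlgEquiv k).toMonoidHom) := by
  set E : IntermediateField k (AlgebraicClosure k) := IntermediateField.adjoin k {x} with hE
  haveI : FiniteDimensional k E :=
    IntermediateField.adjoin.finiteDimensional (Algebra.IsIntegral.isIntegral x)
  set N : IntermediateField k (AlgebraicClosure k) := IntermediateField.normalClosure k E (AlgebraicClosure k)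
    with hN
  haveI : IsGalois k N := isGalois_iff.mpr ⟨inferInstance, inferInstance⟩
  let f := (absoluteGaloisGroup.toAlgEquiv k).toMonoidHom
  have hf : Function.Surjective f := (absoluteGaloisGroup.toAlgEquiv k).surjective
  refine ⟨N.fixingSubgroup.comap f, ?_, ?_, ?_⟩
  · exact (IntermediateField.fixingSubgroup_isOpen N).preimage
      (show Continuous f from continuous_id)
  · exact ((InfiniteGalois.normal_iff_isGalois N).mpr inferInstance).comap f
  · rw [Subgroup.map_comap_eq_self_of_surjective hf, InfiniteGalois.fixedField_fixingSubgroup]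
    exact IntermediateField.le_normalClosure E (IntermediateField.mem_adjoin_simple_self k x)

end Single

/-! ### §2. Gluing -/

section Glue

variable {k₁ k₂ : Type} [Field k₁] [Field k₂] [CharZero k₁] [CharZero k₂]

/-- **The bi-anabelian statement for `k̄^×` from reciprocity families** ([AbsTopIII] Prop. 3.2 (iv)
proof; [AbsAnab] Prop. 1.2.1 (iii), (iv)): for `α : G_{k₁} ⥲ G_{k₂}` and reciprocity data at the open
normal levels as described in the module docstring, there is an `α`-equivariant multiplicative bijection
`(AlgebraicClosure k₁)^× ⥲ (AlgebraicClosure k₂)^×`. [cite: MochizukiAbsTopIII2015, Proposition 3.2 (iv) p.72] -/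
theorem biAnabelianUnits_absoluteGaloisGroup_of_levelFamilies
    (α : absoluteGaloisGroup k₁ ≃ₜ* absoluteGaloisGroup k₂)
    (Art₁ : ∀ U : Subgroup (absoluteGaloisGroup k₁),
      (IntermediateField.fixedField (U.map (absoluteGaloisGroup.toAlgEquiv k₁).toMonoidHom))ˣ →*
        TopologicalAbelianization U)
    (Art₂ : ∀ U' : Subgroup (absoluteGaloisGroup k₂),
      (IntermediateField.fixedField (U'.map (absoluteGaloisGroup.toAlgEquiv k₂).toMonoidHom))ˣ →*
        TopologicalAbelianization U')
    (hinj₁ : ∀ U' : Subgroup (absoluteGaloisGroup k₂), IsOpen (U' : Set (absoluteGaloisGroup k₂)) →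
      U'.Normal → Function.Injective (Art₁ (U'.comap (α : absoluteGaloisGroup k₁ →* absoluteGaloisGroup k₂))))
    (hinj₂ : ∀ U' : Subgroup (absoluteGaloisGroup k₂), IsOpen (U' : Set (absoluteGaloisGroup k₂)) →
      U'.Normal → Function.Injective (Art₂ U'))
    (hrange : ∀ U' : Subgroup (absoluteGaloisGroup k₂), IsOpen (U' : Set (absoluteGaloisGroup k₂)) →
      U'.Normal → ∀ t, t ∈ Set.range (Art₁ (U'.comap (α : absoluteGaloisGroup k₁ →* absoluteGaloisGroup k₂))) ↔
        abelianizationCongr (comapEquiv α U') t ∈ Set.range (Art₂ U'))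
    (hVer₁ : ∀ (U' V' : Subgroup (absoluteGaloisGroup k₂)) (hU' : IsOpen (U' : Set (absoluteGaloisGroup k₂)))
      (hV' : IsOpen (V' : Set (absoluteGaloisGroup k₂))), U'.Normal → V'.Normal → ∀ (h : V' ≤ U') u,
      verlagerung (hU'.preimage α.continuous) (hV'.preimage α.continuous) (Subgroup.comap_mono h)
          (Art₁ (U'.comap (α : absoluteGaloisGroup k₁ →* absoluteGaloisGroup k₂)) u) =
        Art₁ (V'.comap (α : absoluteGaloisGroup k₁ →* absoluteGaloisGroup k₂))
          (Units.map (IntermediateField.inclusion (IntermediateField.fixedField_le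
            (Subgroup.map_mono (Subgroup.comap_mono (f := (α : absoluteGaloisGroup k₁ →* absoluteGaloisGroup k₂)) h)))).toRingHom.toMonoidHom u))
    (hVer₂ : ∀ (U' V' : Subgroup (absoluteGaloisGroup k₂)) (hU' : IsOpen (U' : Set (absoluteGaloisGroup k₂)))
      (hV' : IsOpen (V' : Set (absoluteGaloisGroup k₂))), U'.Normal → V'.Normal → ∀ (h : V' ≤ U') v,
      verlagerung hU' hV' h (Art₂ U' v) =
        Art₂ V' (Units.map (IntermediateField.inclusion (IntermediateField.fixedField_le
          (Subgroup.map_mono h))).toRingHom.toMonoidHom v))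
    (hconj₁ : ∀ U' : Subgroup (absoluteGaloisGroup k₂), IsOpen (U' : Set (absoluteGaloisGroup k₂)) → U'.Normal →
      ∀ (g : absoluteGaloisGroup k₁)
        (u u' : (IntermediateField.fixedField ((U'.comap (α : absoluteGaloisGroup k₁ →* absoluteGaloisGroup k₂)).map
          (absoluteGaloisGroup.toAlgEquiv k₁).toMonoidHom))ˣ)
        (h h' : U'.comap (α : absoluteGaloisGroup k₁ →* absoluteGaloisGroup k₂)),
      ((u' : IntermediateField.fixedField ((U'.comap (α : absoluteGaloisGroup k₁ →* absoluteGaloisGroup k₂)).map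
          (absoluteGaloisGroup.toAlgEquiv k₁).toMonoidHom)) : AlgebraicClosure k₁) =
        g • ((u : IntermediateField.fixedField ((U'.comap (α : absoluteGaloisGroup k₁ →* absoluteGaloisGroup k₂)).map
          (absoluteGaloisGroup.toAlgEquiv k₁).toMonoidHom)) : AlgebraicClosure k₁) →
      (h' : absoluteGaloisGroup k₁) = g * h * g⁻¹ →
      Art₁ _ u = QuotientGroup.mk h → Art₁ _ u' = QuotientGroup.mk h')
    (hconj₂ : ∀ U' : Subgroup (absoluteGaloisGroup k₂), IsOpen (U' : Set (absoluteGaloisGroup k₂)) → U'.Normal →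
      ∀ (g : absoluteGaloisGroup k₂)
        (v v' : (IntermediateField.fixedField (U'.map (absoluteGaloisGroup.toAlgEquiv k₂).toMonoidHom))ˣ)
        (h h' : U'),
      ((v' : IntermediateField.fixedField (U'.map (absoluteGaloisGroup.toAlgEquiv k₂).toMonoidHom)) :
          AlgebraicClosure k₂) =
        g • ((v : IntermediateField.fixedField (U'.map (absoluteGaloisGroup.toAlgEquiv k₂).toMonoidHom)) :
          AlgebraicClosure k₂) →
      (h' : absoluteGaloisGroup k₂) = g * h * g⁻¹ →
      Art₂ U' v = QuotientGroup.mk h → Art₂ U' v' = QuotientGroup.mk h') :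
    ∃ β : (AlgebraicClosure k₁)⁰ ≃* (AlgebraicClosure k₂)⁰,
      ∀ (σ : absoluteGaloisGroup k₁) (x y : (AlgebraicClosure k₁)⁰),
        (y : AlgebraicClosure k₁) = σ • (x : AlgebraicClosure k₁) →
        ((β y : (AlgebraicClosure k₂)⁰) : AlgebraicClosure k₂) =
          α σ • ((β x : (AlgebraicClosure k₂)⁰) : AlgebraicClosure k₂) := by
  -- Notation inside the proof: `F₁ U` / `F₂ U'` are the fixed fields, `cα` the coercion of `α`.
  set cα : absoluteGaloisGroup k₁ →* absoluteGaloisGroup k₂ := (α : absoluteGaloisGroup k₁ →* absoluteGaloisGroup k₂)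
    with hcα
  -- Step 0: the levelwise bijections
  have hB0 : ∀ (U' : Subgroup (absoluteGaloisGroup k₂)) (hU' : IsOpen (U' : Set (absoluteGaloisGroup k₂)))
      (hN' : U'.Normal),
      ∃ β : (IntermediateField.fixedField ((U'.comap cα).map (absoluteGaloisGroup.toAlgEquiv k₁).toMonoidHom))ˣ ≃*
          (IntermediateField.fixedField (U'.map (absoluteGaloisGroup.toAlgEquiv k₂).toMonoidHom))ˣ,
        ∀ u, Art₂ U' (β u) = abelianizationCongr (comapEquiv α U') (Art₁ _ u) :=
    fun U' hU' hN' => exists_levelUnitsIso α U' (Art₁ _) (Art₂ U') (hinj₁ U' hU' hN') (hinj₂ U' hU' hN')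
      (hrange U' hU' hN')
  choose B hB using hB0
  -- Step 1: coverings by the fixed fields of open normal subgroups
  have hcov₁ : ∀ x : AlgebraicClosure k₁, ∃ (U' : Subgroup (absoluteGaloisGroup k₂))
      (_ : IsOpen (U' : Set (absoluteGaloisGroup k₂))) (_ : U'.Normal),
      x ∈ IntermediateField.fixedField ((U'.comap cα).map (absoluteGaloisGroup.toAlgEquiv k₁).toMonoidHom) := by
    intro x
    obtain ⟨U, hU, hN, hx⟩ := exists_open_normal_mem_fixedField x
    refine ⟨U.map cα, ?_, ?_, ?_⟩
    · have hset : ((U.map cα : Subgroup (absoluteGaloisGroup k₂)) : Set (absoluteGaloisGroup k₂)) = α '' U := by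
        rw [hcα, Subgroup.coe_map]; rfl
      rw [hset]
      exact α.toHomeomorph.isOpenMap _ hU
    · exact hN.map cα (by rw [hcα]; exact α.surjective)
    · rwa [Subgroup.comap_map_eq_self_of_injective (by rw [hcα]; exact α.injective)]
  have hcov₂ : ∀ y : AlgebraicClosure k₂, ∃ (U' : Subgroup (absoluteGaloisGroup k₂))
      (_ : IsOpen (U' : Set (absoluteGaloisGroup k₂))) (_ : U'.Normal),
      y ∈ IntermediateField.fixedField (U'.map (absoluteGaloisGroup.toAlgEquiv k₂).toMonoidHom) :=
    fun y => by
      obtain ⟨U, hU, hN, hy⟩ := exists_open_normal_mem_fixedField y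
      exact ⟨U, hU, hN, hy⟩
  -- inclusions of fixed fields along `V' ≤ U'`
  have hle₁ : ∀ {U' V' : Subgroup (absoluteGaloisGroup k₂)}, V' ≤ U' →
      IntermediateField.fixedField ((U'.comap cα).map (absoluteGaloisGroup.toAlgEquiv k₁).toMonoidHom) ≤
        IntermediateField.fixedField ((V'.comap cα).map (absoluteGaloisGroup.toAlgEquiv k₁).toMonoidHom) :=
    fun h => IntermediateField.fixedField_le (Subgroup.map_mono (Subgroup.comap_mono h))
  have hle₂ : ∀ {U' V' : Subgroup (absoluteGaloisGroup k₂)}, V' ≤ U' →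
      IntermediateField.fixedField (U'.map (absoluteGaloisGroup.toAlgEquiv k₂).toMonoidHom) ≤
        IntermediateField.fixedField (V'.map (absoluteGaloisGroup.toAlgEquiv k₂).toMonoidHom) :=
    fun h => IntermediateField.fixedField_le (Subgroup.map_mono h)
  -- Step 2: compatibility of the levelwise bijections (values in `k̄₂`)
  have hcompat : ∀ (U' V' : Subgroup (absoluteGaloisGroup k₂)) (hU' : IsOpen (U' : Set (absoluteGaloisGroup k₂)))
      (hV' : IsOpen (V' : Set (absoluteGaloisGroup k₂))) (hNU : U'.Normal) (hNV : V'.Normal) (h : V' ≤ U')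
      (u : (IntermediateField.fixedField ((U'.comap cα).map (absoluteGaloisGroup.toAlgEquiv k₁).toMonoidHom))ˣ),
      (((B V' hV' hNV (Units.map (IntermediateField.inclusion (hle₁ h)).toRingHom.toMonoidHom u)) :
          IntermediateField.fixedField (V'.map (absoluteGaloisGroup.toAlgEquiv k₂).toMonoidHom)) :
            AlgebraicClosure k₂) =
        (((B U' hU' hNU u) : IntermediateField.fixedField (U'.map (absoluteGaloisGroup.toAlgEquiv k₂).toMonoidHom)) :
            AlgebraicClosure k₂) := by
    intro U' V' hU' hV' hNU hNV h u
    have key := levelUnitsIso_compatible α hU' hV' h (Art₁ _) (Art₁ _) (Art₂ U') (Art₂ V') (hinj₂ V' hV' hNV)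
      (hVer₁ U' V' hU' hV' hNU hNV h) (hVer₂ U' V' hU' hV' hNU hNV h) (hB U' hU' hNU) (hB V' hV' hNV) u
    rw [key]
    rfl
  -- units attached to non-zero elements of the fixed fields
  have hmk₁ : ∀ (U' : Subgroup (absoluteGaloisGroup k₂)) {x : AlgebraicClosure k₁} (hx0 : x ≠ 0)
      (hx : x ∈ IntermediateField.fixedField ((U'.comap cα).map (absoluteGaloisGroup.toAlgEquiv k₁).toMonoidHom)),
      (⟨x, hx⟩ : IntermediateField.fixedField ((U'.comap cα).map (absoluteGaloisGroup.toAlgEquiv k₁).toMonoidHom)) ≠ 0 :=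
    fun U' x hx0 hx h => hx0 (congrArg Subtype.val h)
  have hmk₂ : ∀ (U' : Subgroup (absoluteGaloisGroup k₂)) {y : AlgebraicClosure k₂} (hy0 : y ≠ 0)
      (hy : y ∈ IntermediateField.fixedField (U'.map (absoluteGaloisGroup.toAlgEquiv k₂).toMonoidHom)),
      (⟨y, hy⟩ : IntermediateField.fixedField (U'.map (absoluteGaloisGroup.toAlgEquiv k₂).toMonoidHom)) ≠ 0 :=
    fun U' y hy0 hy h => hy0 (congrArg Subtype.val h)
  -- the value at a level
  have hval_indep : ∀ (x : AlgebraicClosure k₁) (hx0 : x ≠ 0)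
      (U₁ U₂ : Subgroup (absoluteGaloisGroup k₂)) (hU₁ : IsOpen (U₁ : Set (absoluteGaloisGroup k₂)))
      (hU₂ : IsOpen (U₂ : Set (absoluteGaloisGroup k₂))) (hN₁ : U₁.Normal) (hN₂ : U₂.Normal)
      (hx₁ : x ∈ IntermediateField.fixedField ((U₁.comap cα).map (absoluteGaloisGroup.toAlgEquiv k₁).toMonoidHom))
      (hx₂ : x ∈ IntermediateField.fixedField ((U₂.comap cα).map (absoluteGaloisGroup.toAlgEquiv k₁).toMonoidHom)),
      (((B U₁ hU₁ hN₁ (Units.mk0 ⟨x, hx₁⟩ (hmk₁ U₁ hx0 hx₁))) :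
          IntermediateField.fixedField (U₁.map (absoluteGaloisGroup.toAlgEquiv k₂).toMonoidHom)) : AlgebraicClosure k₂) =
        (((B U₂ hU₂ hN₂ (Units.mk0 ⟨x, hx₂⟩ (hmk₁ U₂ hx0 hx₂))) :
          IntermediateField.fixedField (U₂.map (absoluteGaloisGroup.toAlgEquiv k₂).toMonoidHom)) : AlgebraicClosure k₂) := by
    intro x hx0 U₁ U₂ hU₁ hU₂ hN₁ hN₂ hx₁ hx₂
    have hW : IsOpen ((U₁ ⊓ U₂ : Subgroup (absoluteGaloisGroup k₂)) : Set (absoluteGaloisGroup k₂)) := hU₁.inter hU₂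
    have hNW : (U₁ ⊓ U₂).Normal :=
      ⟨fun n hn g => ⟨hN₁.conj_mem n hn.1 g, hN₂.conj_mem n hn.2 g⟩⟩
    rw [← hcompat U₁ (U₁ ⊓ U₂) hU₁ hW hN₁ hNW inf_le_left, ← hcompat U₂ (U₁ ⊓ U₂) hU₂ hW hN₂ hNW inf_le_right]
    congr 2
  -- Step 3: the global map on non-zero elements
  choose U₀ hU₀ hN₀ hmem₀ using hcov₁
  let b : (AlgebraicClosure k₁)⁰ → AlgebraicClosure k₂ := fun x =>
    ((B (U₀ x) (hU₀ x) (hN₀ x) (Units.mk0 ⟨(x : AlgebraicClosure k₁), hmem₀ x⟩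
        (hmk₁ (U₀ x) (nonZeroDivisors.ne_zero x.2) (hmem₀ x))) :
      IntermediateField.fixedField ((U₀ x).map (absoluteGaloisGroup.toAlgEquiv k₂).toMonoidHom)) : AlgebraicClosure k₂)
  have hb : ∀ (x : (AlgebraicClosure k₁)⁰) (U' : Subgroup (absoluteGaloisGroup k₂))
      (hU' : IsOpen (U' : Set (absoluteGaloisGroup k₂))) (hN' : U'.Normal)
      (hx : (x : AlgebraicClosure k₁) ∈
        IntermediateField.fixedField ((U'.comap cα).map (absoluteGaloisGroup.toAlgEquiv k₁).toMonoidHom)),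
      b x = (((B U' hU' hN' (Units.mk0 ⟨(x : AlgebraicClosure k₁), hx⟩
          (hmk₁ U' (nonZeroDivisors.ne_zero x.2) hx))) :
        IntermediateField.fixedField (U'.map (absoluteGaloisGroup.toAlgEquiv k₂).toMonoidHom)) : AlgebraicClosure k₂) :=
    fun x U' hU' hN' hx => hval_indep _ (nonZeroDivisors.ne_zero x.2) _ _ _ _ _ _ _ _
  have hb0 : ∀ x, b x ≠ 0 := by
    intro x h
    exact (B (U₀ x) (hU₀ x) (hN₀ x) _).ne_zero (Subtype.ext h)
  -- multiplicativity
  have hbmul : ∀ x y : (AlgebraicClosure k₁)⁰, b (x * y) = b x * b y := by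
    intro x y
    set W : Subgroup (absoluteGaloisGroup k₂) := U₀ x ⊓ U₀ y with hWdef
    have hW : IsOpen (W : Set (absoluteGaloisGroup k₂)) := (hU₀ x).inter (hU₀ y)
    have hNW : W.Normal := ⟨fun n hn g => ⟨(hN₀ x).conj_mem n hn.1 g, (hN₀ y).conj_mem n hn.2 g⟩⟩
    have hxW := hle₁ (inf_le_left : W ≤ U₀ x) (hmem₀ x)
    have hyW := hle₁ (inf_le_right : W ≤ U₀ y) (hmem₀ y)
    have hxyW : ((x * y : (AlgebraicClosure k₁)⁰) : AlgebraicClosure k₁) ∈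
        IntermediateField.fixedField ((W.comap cα).map (absoluteGaloisGroup.toAlgEquiv k₁).toMonoidHom) := by
      rw [Submonoid.coe_mul]; exact mul_mem hxW hyW
    rw [hb (x * y) W hW hNW hxyW, hb x W hW hNW hxW, hb y W hW hNW hyW]
    have hprod : Units.mk0 (⟨((x * y : (AlgebraicClosure k₁)⁰) : AlgebraicClosure k₁), hxyW⟩ :
        IntermediateField.fixedField ((W.comap cα).map (absoluteGaloisGroup.toAlgEquiv k₁).toMonoidHom))
          (hmk₁ W (nonZeroDivisors.ne_zero (x * y).2) hxyW) =
        Units.mk0 ⟨(x : AlgebraicClosure k₁), hxW⟩ (hmk₁ W (nonZeroDivisors.ne_zero x.2) hxW) *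
          Units.mk0 ⟨(y : AlgebraicClosure k₁), hyW⟩ (hmk₁ W (nonZeroDivisors.ne_zero y.2) hyW) :=
      Units.ext (Subtype.ext (by
        rw [Units.val_mul, Units.val_mk0, Units.val_mk0, Units.val_mk0, MulMemClass.coe_mul]
        rfl))
    rw [hprod, map_mul]
    rfl
  -- Step 4: the monoid isomorphism
  let β₀ : (AlgebraicClosure k₁)⁰ →* (AlgebraicClosure k₂)⁰ :=
    { toFun := fun x => ⟨b x, mem_nonZeroDivisors_of_ne_zero (hb0 x)⟩
      map_one' := by
        apply Subtype.ext
        have h1 : b 1 * b 1 = b 1 := by rw [← hbmul, mul_one]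
        exact (mul_right_eq_self₀.mp h1).resolve_right (hb0 1)
      map_mul' := fun x y => Subtype.ext (hbmul x y) }
  have hβ₀ : ∀ x, ((β₀ x : (AlgebraicClosure k₂)⁰) : AlgebraicClosure k₂) = b x := fun _ => rfl
  have hinj : Function.Injective β₀ := by
    intro x y hxy
    have hxy' : b x = b y := by rw [← hβ₀, ← hβ₀, hxy]
    set W : Subgroup (absoluteGaloisGroup k₂) := U₀ x ⊓ U₀ y with hWdef
    have hW : IsOpen (W : Set (absoluteGaloisGroup k₂)) := (hU₀ x).inter (hU₀ y)
    have hNW : W.Normal := ⟨fun n hn g => ⟨(hN₀ x).conj_mem n hn.1 g, (hN₀ y).conj_mem n hn.2 g⟩⟩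
    have hxW := hle₁ (inf_le_left : W ≤ U₀ x) (hmem₀ x)
    have hyW := hle₁ (inf_le_right : W ≤ U₀ y) (hmem₀ y)
    rw [hb x W hW hNW hxW, hb y W hW hNW hyW] at hxy'
    have h1 := (B W hW hNW).injective (Units.ext (Subtype.ext hxy'))
    have h2 := congrArg (fun u : (IntermediateField.fixedField ((W.comap cα).map
      (absoluteGaloisGroup.toAlgEquiv k₁).toMonoidHom))ˣ => ((u : IntermediateField.fixedField
        ((W.comap cα).map (absoluteGaloisGroup.toAlgEquiv k₁).toMonoidHom)) : AlgebraicClosure k₁)) h1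
    exact Subtype.ext (by simpa using h2)
  have hsurj : Function.Surjective β₀ := by
    intro y
    obtain ⟨U', hU', hN', hy⟩ := hcov₂ (y : AlgebraicClosure k₂)
    set v : (IntermediateField.fixedField (U'.map (absoluteGaloisGroup.toAlgEquiv k₂).toMonoidHom))ˣ :=
      Units.mk0 ⟨(y : AlgebraicClosure k₂), hy⟩ (hmk₂ U' (nonZeroDivisors.ne_zero y.2) hy) with hv
    set u := (B U' hU' hN').symm v with hu
    have hx0 : (((u : IntermediateField.fixedField ((U'.comap cα).map
        (absoluteGaloisGroup.toAlgEquiv k₁).toMonoidHom))) : AlgebraicClosure k₁) ≠ 0 :=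
      fun h => u.ne_zero (Subtype.ext h)
    refine ⟨⟨_, mem_nonZeroDivisors_of_ne_zero hx0⟩, Subtype.ext ?_⟩
    rw [hβ₀, hb _ U' hU' hN' (u : IntermediateField.fixedField ((U'.comap cα).map
        (absoluteGaloisGroup.toAlgEquiv k₁).toMonoidHom)).2]
    have hmk : Units.mk0 (⟨((u : IntermediateField.fixedField ((U'.comap cα).map
        (absoluteGaloisGroup.toAlgEquiv k₁).toMonoidHom)) : AlgebraicClosure k₁), (u : IntermediateField.fixedField
          ((U'.comap cα).map (absoluteGaloisGroup.toAlgEquiv k₁).toMonoidHom)).2⟩ :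
        IntermediateField.fixedField ((U'.comap cα).map (absoluteGaloisGroup.toAlgEquiv k₁).toMonoidHom))
          (hmk₁ U' hx0 _) = u := Units.ext (Subtype.ext rfl)
    rw [hmk, hu, MulEquiv.apply_symm_apply]
    rfl
  refine ⟨MulEquiv.ofBijective β₀ ⟨hinj, hsurj⟩, fun σ x y hxy => ?_⟩
  -- Step 5: equivariance
  show ((β₀ y : (AlgebraicClosure k₂)⁰) : AlgebraicClosure k₂) = α σ • ((β₀ x : (AlgebraicClosure k₂)⁰) : AlgebraicClosure k₂)
  rw [hβ₀, hβ₀]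
  set U' := U₀ x with hU'def
  have hU' := hU₀ x
  have hN' := hN₀ x
  have hNc : (U'.comap cα).Normal := hN'.comap cα
  have hx := hmem₀ x
  have hy : (y : AlgebraicClosure k₁) ∈
      IntermediateField.fixedField ((U'.comap cα).map (absoluteGaloisGroup.toAlgEquiv k₁).toMonoidHom) := by
    rw [hxy]; exact smul_mem_fixedField_map _ hNc σ hx
  set u : (IntermediateField.fixedField ((U'.comap cα).map (absoluteGaloisGroup.toAlgEquiv k₁).toMonoidHom))ˣ :=
    Units.mk0 ⟨(x : AlgebraicClosure k₁), hx⟩ (hmk₁ U' (nonZeroDivisors.ne_zero x.2) hx) with hudef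
  set u' : (IntermediateField.fixedField ((U'.comap cα).map (absoluteGaloisGroup.toAlgEquiv k₁).toMonoidHom))ˣ :=
    Units.mk0 ⟨(y : AlgebraicClosure k₁), hy⟩ (hmk₁ U' (nonZeroDivisors.ne_zero y.2) hy) with hu'def
  have hbx : b x = (((B U' hU' hN' u) : IntermediateField.fixedField (U'.map
      (absoluteGaloisGroup.toAlgEquiv k₂).toMonoidHom)) : AlgebraicClosure k₂) := rfl
  have hmemv : α σ • b x ∈ IntermediateField.fixedField (U'.map (absoluteGaloisGroup.toAlgEquiv k₂).toMonoidHom) := by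
    rw [hbx]; exact smul_mem_fixedField_map _ hN' (α σ) (B U' hU' hN' u : IntermediateField.fixedField
      (U'.map (absoluteGaloisGroup.toAlgEquiv k₂).toMonoidHom)).2
  have hv0 : α σ • b x ≠ 0 := by
    rw [Ne, smul_eq_zero_iff_eq]; exact hb0 x
  set v' : (IntermediateField.fixedField (U'.map (absoluteGaloisGroup.toAlgEquiv k₂).toMonoidHom))ˣ :=
    Units.mk0 ⟨α σ • b x, hmemv⟩ (hmk₂ U' hv0 hmemv) with hv'def
  have key := levelUnitsIso_equivariant α U' (Art₁ _) (Art₂ U') (hinj₂ U' hU' hN') (hconj₁ U' hU' hN')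
    (hconj₂ U' hU' hN') (hB U' hU' hN') σ u u' (by rw [hudef, hu'def]; simpa using hxy) v'
    (by rw [hv'def]; simp [hbx]) (fun h => hNc.conj_mem _ h.2 σ)
  rw [hb y U' hU' hN' hy]
  show (((B U' hU' hN' u') : IntermediateField.fixedField (U'.map
      (absoluteGaloisGroup.toAlgEquiv k₂).toMonoidHom)) : AlgebraicClosure k₂) = α σ • b x
  rw [key]
  rfl

end Glue

end Literature.AnabelianGeometry.AbsoluteAnabelian

end
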